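import Summits.CriticalPhenomena.PercolationContinuityZ3.Theses.PercShatteringRace
import HarnessLib

/-!
# Route PercShatteringRace — `ThesisOfCruxes` (stmt-CriticalPhenomena-14153)

`ThesisOfCruxes : FreeSusceptibilityPowerSaving → NearLinearTwoClusterDecay → Thesis` is pure
bookkeeping: the route's target `Thesis` is, verbatim, the conjunction `S(1/2) ∧ U(1/6)` of the two
crux Props `FreeSusceptibilityPowerSaving` (free-box susceptibility power saving at exponent `5/2`)
and `NearLinearTwoClusterDecay` (two-cluster decay at aspect `n^{7/6}`), so the two cruxes give the
target by pairing.
-/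

namespace Summit.CriticalPhenomena.PercolationContinuityZ3.Theorems

/-- **Glue of route PercShatteringRace** (item `stmt-CriticalPhenomena-14153`, exact route decl):
the two cruxes `S(1/2) = FreeSusceptibilityPowerSaving` and `U(1/6) = NearLinearTwoClusterDecay`
give the route target `Thesis`, which unfolds to their conjunction; the proof is the pairing
`fun hS hU => ⟨hS, hU⟩`. -/
theorem thesisOfCruxes_proof :
    Summit.CriticalPhenomena.PercolationContinuityZ3.Theses.PercShatteringRace.ThesisOfCruxes := by
  unfold Summit.CriticalPhenomena.PercolationContinuityZ3.Theses.PercShatteringRace.ThesisOfCruxes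
  intro hS hU
  exact ⟨hS, hU⟩

end Summit.CriticalPhenomena.PercolationContinuityZ3.Theorems
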